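import Summits.CriticalPhenomena.Ising3DConformalLimit.Theorems.AnomalousForcesInteractionGaussianLimitIsFreeSphereDecouplingRigidity
import Literature.MathematicalPhysics.QuantumLattice.LatticeFieldShellMarkov
import HarnessLib

/-!
# Crux `GaussianLimitIsFree` (item stmt-CriticalPhenomena-2601), line `registered` (v10, lead c4):
# the decoupling inequality (D) HOLDS for every lattice law — only its survival in the limit is open

THEOREM-ONLY file (`--supports stmt-CriticalPhenomena-2601`, registered sub-goal
`stub_sphereDecoupling_spinFieldLaw`).  Skeleton v10 of the crux has ONE stub, `stub_sphereDecoupling_limit`: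
the `L²` decoupling inequality across the unit sphere

  (D_ε)  `|∫ ω(w)ω(v) dμ| ≤ (∫ E_μ[ω(w) | 𝒜((∂B)^ε)]² dμ)^{1/2} (∫ ω(v)² dμ)^{1/2}`
         (`w` supported in `B(0,1)`, `v` supported off `B̄(0, 1+ε)`)

for the realised (Gaussian) LIMIT law `μ` of a `U₄`-free scaling limit of `criticalCorr 3`.  This file
proves (D_ε) for every LATTICE law at mesh `δ < ε`:

* `sphereDecoupling_spinFieldLaw_isingMeasure` — for the law `μ_δ = spinFieldLaw (μ^{ηbc}_{Λ;β,h}) Λ δ ρ` on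
  `𝒮'(ℝ³)` of the smeared spin field `Φ_δ = ρ δ³ ∑_{x ∈ Λ} σ_x δ_{δx}` of the finite-volume Ising model on `ℤ³`
  (ANY volume `Λ`, inverse temperature `β`, field `h`, fixed boundary condition `ηbc`, field strength
  `ρ ≠ 0`) and every `0 < δ < ε`, (D_ε) holds: the lattice field is Markov across the shell
  `B(0,1+ε) ∖ B̄(0,1)` (`condIndepCondExp_shell_spinFieldLaw_isingMeasure`, Friedli–Velenik (3.26)
  transported to `𝒮'`), and thick-shell splitting gives (D) (`sphereDecoupling_of_shellSplitting`); the
  evaluations are bounded (`|Φ_δ(σ)(f)| ≤ |ρ| δ³ ∑ |f(δx)|`), hence in `L²`.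
* `not_sphereDecoupling_of_ne_half` — conversely (D) FAILS, at some width `ε < ε₀`, for every centred
  Gaussian law with moment densities `(√A)ⁿ·W_Δ`, `Δ ∈ (1/2, 1]` (contrapositive of
  `delta_eq_half_of_sphereDecoupling`): the generalised free field is the witness the inheritance must exclude.

So the crux is EXACTLY the survival of (D) under the scaling limit `μ_δ ⇀ μ` (same σ-algebras
`fieldSigma`/`extEvents` on `𝒮'(ℝ³)` on both sides); neither conditional independence nor the
conditional-expectation norm in (D) is weakly continuous (under `μ_δ` the collar σ-algebra sees every single
spin through bumps of radius `< δ`, `measurable_apply_comap_spinField`, information of vanishing amplitude in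
the limit), which is why no theorem here touches the limit.

References: S. Friedli, Y. Velenik, *Statistical Mechanics of Lattice Systems* (2017), §3.6.3 eq. (3.26);
Yu. A. Rozanov, *Markov Random Fields* (1982), Ch. 2 §1.1, Ch. 3 §2.3.
-/

noncomputable section

namespace Summit.CriticalPhenomena.Ising3DConformalLimit.Cruxes.GaussianLimitIsFree.Birth

open MeasureTheory Filter Set
open scoped ProbabilityTheory Topology ENNReal
open Literature.MathematicalPhysics.QuantumLattice
open Literature.Probability.LatticeModels

section Lattice

open scoped SchwartzMap

/-- Evaluations of the smeared spin field are bounded: `|Φ_δ(σ)(f)| ≤ ∑_{x ∈ Λ} |ρ δ³ f(δx)|`.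
[folklore] -/
theorem abs_spinField_apply_le (Λ : Finset (Site 3)) (δ ρ : ℝ) (σ : SpinConfig (Site 3))
    (f : 𝓢(EuclideanSpace ℝ (Fin 3), ℝ)) :
    |spinField Λ δ ρ σ f| ≤ ∑ x ∈ Λ, |ρ * δ ^ 3 * f (δ • siteToE x)| := by
  rw [spinField_apply]
  refine (Finset.abs_sum_le_sum_abs _ _).trans (Finset.sum_le_sum fun x _ => ?_)
  rw [abs_mul (ρ * δ ^ 3 * spinAt x σ), abs_mul (ρ * δ ^ 3), abs_spinAt, mul_one, ← abs_mul]

/-- Evaluations are in `L²` of every lattice law `spinFieldLaw ν Λ δ ρ` with `ν` a probability measure on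
spin configurations (they are bounded on the image of the smearing map). [folklore] -/
theorem memLp_two_eval_spinFieldLaw (ν : Measure (SpinConfig (Site 3))) [IsProbabilityMeasure ν]
    (Λ : Finset (Site 3)) (δ ρ : ℝ) (f : 𝓢(EuclideanSpace ℝ (Fin 3), ℝ)) :
    MemLp (fun ω : FieldConfig (EuclideanSpace ℝ (Fin 3)) => ω f) 2 (spinFieldLaw ν Λ δ ρ) := by
  rw [spinFieldLaw]
  refine (memLp_map_measure_iff (measurable_eval f).aestronglyMeasurable
    (measurable_spinField Λ δ ρ).aemeasurable).2 ?_
  refine memLp_of_bounded (a := -(∑ x ∈ Λ, |ρ * δ ^ 3 * f (δ • siteToE x)|))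
    (b := ∑ x ∈ Λ, |ρ * δ ^ 3 * f (δ • siteToE x)|) (Eventually.of_forall fun σ => ?_)
    ((measurable_eval f).comp (measurable_spinField Λ δ ρ)).aestronglyMeasurable 2
  exact abs_le.1 (abs_spinField_apply_le Λ δ ρ σ f)

/-- **(D) holds on the lattice.**  For the finite-volume Ising model on `ℤ³` in any volume `Λ` (any `β`,
`h`, fixed boundary condition `ηbc`), mesh `0 < δ < ε` and field strength `ρ ≠ 0`, the law `μ_δ` of the
smeared spin field satisfies the `L²` decoupling inequality across the unit sphere at width `ε`: for `w`
supported in the open unit ball and `v` supported off `B̄(0, 1+ε)`,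
`|∫ ω(w)ω(v) dμ_δ| ≤ (∫ E_{μ_δ}[ω(w) | fieldSigma ((∂B)^ε)]² dμ_δ)^{1/2} (∫ ω(v)² dμ_δ)^{1/2}`
(shell Markov property of the lattice field, `condIndepCondExp_shell_spinFieldLaw_isingMeasure`, and
`sphereDecoupling_of_shellSplitting`). [cite: FriedliVelenik2017, Exercise 3.11, eq. (3.26)] -/
theorem sphereDecoupling_spinFieldLaw_isingMeasure (Λ : Finset (Site 3)) (β h : ℝ)
    (ηbc : SpinConfig (Site 3)) {δ ρ ε : ℝ} (hδ : 0 < δ) (hρ : ρ ≠ 0) (hδε : δ < ε)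
    {w v : 𝓢(EuclideanSpace ℝ (Fin 3), ℝ)}
    (hw : tsupport ⇑w ⊆ Metric.ball (0 : EuclideanSpace ℝ (Fin 3)) 1)
    (hv : tsupport ⇑v ⊆ (Metric.closedBall (0 : EuclideanSpace ℝ (Fin 3)) (1 + ε))ᶜ) :
    |∫ ω, ω w * ω v ∂(spinFieldLaw (isingMeasure (zdGraph 3) Λ β h (.fixed ηbc)) Λ δ ρ)| ≤
      Real.sqrt (∫ ω, ((spinFieldLaw (isingMeasure (zdGraph 3) Λ β h (.fixed ηbc)) Λ δ ρ)[
          (fun ω : FieldConfig (EuclideanSpace ℝ (Fin 3)) => ω w) |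
          fieldSigma (Metric.thickening ε (Metric.sphere (0 : EuclideanSpace ℝ (Fin 3)) 1))]) ω ^ 2
          ∂(spinFieldLaw (isingMeasure (zdGraph 3) Λ β h (.fixed ηbc)) Λ δ ρ)) *
      Real.sqrt (∫ ω, (ω v) ^ 2 ∂(spinFieldLaw (isingMeasure (zdGraph 3) Λ β h (.fixed ηbc)) Λ δ ρ)) := by
  have hshell := condIndepCondExp_shell_spinFieldLaw_isingMeasure Λ β h ηbc hδ hρ
    (0 : EuclideanSpace ℝ (Fin 3)) 1 ε hδε
  exact sphereDecoupling_of_shellSplitting (hδ.trans hδε).le hshell hw hv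
    (memLp_two_eval_spinFieldLaw _ Λ δ ρ w) (memLp_two_eval_spinFieldLaw _ Λ δ ρ v)

/-- **Registered form (sub-goal `stub_sphereDecoupling_spinFieldLaw` of crux stmt-CriticalPhenomena-2601,
skeleton v10): (D) for every lattice law at mesh `δ < ε`** — `sphereDecoupling_spinFieldLaw_isingMeasure` with
all arguments explicit; compare the open stub `stub_sphereDecoupling_limit` (the same inequality for the limit
law). [cite: FriedliVelenik2017, Exercise 3.11, eq. (3.26)] -/
theorem stub_sphereDecoupling_spinFieldLaw :
    ∀ (Λ : Finset (Literature.Probability.LatticeModels.Site 3)) (β h : ℝ) (ηbc : Literature.Probability.LatticeModels.SpinConfig (Literature.Probability.LatticeModels.Site 3)) (δ ρ ε : ℝ), 0 < δ → ρ ≠ 0 → δ < ε → ∀ (w v : SchwartzMap (EuclideanSpace ℝ (Fin 3)) ℝ), tsupport ⇑w ⊆ Metric.ball (0 : EuclideanSpace ℝ (Fin 3)) 1 → tsupport ⇑v ⊆ (Metric.closedBall (0 : EuclideanSpace ℝ (Fin 3)) (1 + ε))ᶜ → |∫ ω, ω w * ω v ∂(Literature.MathematicalPhysics.QuantumLattice.spinFieldLaw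 (Literature.Probability.LatticeModels.isingMeasure (Literature.Probability.LatticeModels.zdGraph 3) Λ β h (Literature.Probability.LatticeModels.BoundaryCondition.fixed ηbc)) Λ δ ρ)| ≤ Real.sqrt (∫ ω, (MeasureTheory.condExp (Literature.MathematicalPhysics.QuantumLattice.fieldSigma (Metric.thickening ε (Metric.sphere (0 : EuclideanSpace ℝ (Fin 3)) 1))) (Literature.MathematicalPhysics.QuantumLattice.spinFieldLaw (Literature.Probability.LatticeModels.isingMeasure (Literature.Probability.LatticeModels.zdGraph 3) Λ β h (Literature.Probability.LatticeModels.BoundaryCondition.fixed ηbc)) Λ δ ρ) (fun ω : Literature.MathematicalPhysics.QuantumLattice.FieldConfig (EuclideanSpace ℝ (Fin 3)) => ω w)) ω ^ 2 ∂(Literature.MathematicalPhysics.QuantumLattice.spinFieldLaw (Literature.Probability.LatticeModels.isingMeasure (Literature.Probability.LatticeModels.zdGraph 3) Λ β h (Literature.Probability.LatticeModels.BoundaryCondition.fixed ηbc)) Λ δ ρ)) * Real.sqrt (∫ ω, (ω v) ^ 2 ∂(Literature.MathematicalPhysics.QuantumLattice.spinFieldLaw (Literature.Probability.LatticeModels.isingMeasure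 (Literature.Probability.LatticeModels.zdGraph 3) Λ β h (Literature.Probability.LatticeModels.BoundaryCondition.fixed ηbc)) Λ δ ρ)) := by
  intro Λ β h ηbc δ ρ ε hδ hρ hδε w v hw hv
  exact sphereDecoupling_spinFieldLaw_isingMeasure Λ β h ηbc hδ hρ hδε hw hv

end Lattice

section Witness

open scoped SchwartzMap

/-- **(D) fails for the generalised free field with `Δ ≠ 1/2`** (contrapositive of
`delta_eq_half_of_sphereDecoupling`): for `A > 0`, `1/2 < Δ ≤ 1` and a centred Gaussian probability law on
`𝒮'(ℝ³)` with moment densities `(√A)ⁿ·W_Δ`, for every `ε₀ > 0` there are a width `ε ∈ (0, ε₀)`, a test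
function `w` supported in the open unit ball and a `v` supported off `B̄(0, 1+ε)` violating the decoupling
inequality — the witness any Markov-inheritance argument has to exclude. [cite: Rozanov1982, Ch. 3 §2.3 Theorem (p. 115)] -/
theorem not_sphereDecoupling_of_ne_half {Δ A : ℝ} (hA : 0 < A) (hΔ : 1 / 2 < Δ) (hΔ1 : Δ ≤ 1)
    (μ : Measure (FieldConfig (EuclideanSpace ℝ (Fin 3)))) [IsProbabilityMeasure μ]
    (hG : IsGaussianField μ)
    (hmom : ∀ (n : ℕ) (f : Fin n → SchwartzMap (EuclideanSpace ℝ (Fin 3)) ℝ), moment μ n f =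
      ∫ x : Fin n → EuclideanSpace ℝ (Fin 3),
        (Real.sqrt A ^ n * Summit.CriticalPhenomena.Ising3DConformalLimit.MoebiusLimitExistsOnlyInteraction.wickPower Δ n x) *
          ∏ i, f i (x i))
    {ε₀ : ℝ} (hε₀ : 0 < ε₀) :
    ∃ (ε : ℝ) (w v : 𝓢(EuclideanSpace ℝ (Fin 3), ℝ)), 0 < ε ∧ ε < ε₀ ∧
      tsupport ⇑w ⊆ Metric.ball (0 : EuclideanSpace ℝ (Fin 3)) 1 ∧
      tsupport ⇑v ⊆ (Metric.closedBall (0 : EuclideanSpace ℝ (Fin 3)) (1 + ε))ᶜ ∧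
      Real.sqrt (∫ ω, (μ[(fun ω : FieldConfig (EuclideanSpace ℝ (Fin 3)) => ω w) |
          fieldSigma (Metric.thickening ε (Metric.sphere (0 : EuclideanSpace ℝ (Fin 3)) 1))]) ω ^ 2 ∂μ) *
        Real.sqrt (∫ ω, (ω v) ^ 2 ∂μ) < |∫ ω, ω w * ω v ∂μ| := by
  by_contra hcon
  push Not at hcon
  have h := delta_eq_half_of_sphereDecoupling Δ A μ hA hΔ.le hΔ1 inferInstance hG hmom ε₀ hε₀
    (fun ε hε hεε₀ w v hw hv => hcon ε w v hε hεε₀ hw hv)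
  linarith

end Witness

end Summit.CriticalPhenomena.Ising3DConformalLimit.Cruxes.GaussianLimitIsFree.Birth

end
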